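import Literature.Computability.Complexity.FlatPrograms
import Literature.Computability.Complexity.ListBricks
import HarnessLib

/-!
# The universal step: one step of an arbitrary flat program is ONE polynomial-time string function

Third stage of the tree's efficient universal machine (Arora–Barak 2009, §1.4, Thm. 1.9: "there
exists a TM `U` such that `U(x, α) = M_α(x)` … with polynomial overhead"; after
`PolyTimeCountable.lean`: bundled `TM2` machine ↦ standard machine, and `FlatPrograms.lean`:
standard machine ↦ flat `goto`/`push`/`pop` program `P` with total one-step semantics
`FlatProg.step P` on configurations `(pc, stacks)`). Here programs and configurations are
written as BIT STRINGS and the step function becomes uniform in the program: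

* the coding (`UnivStep.bin = encodeNat`, `encStack`, `encStacks`, `encTbl`, `encInstr`,
  `encProg`, `encCfg`, `enc P c = ⟨encProg P, ⟨bin pc, encStacks stacks⟩⟩`) by the nested-pair
  records and coded lists of the tree's `FP` string algebra (`boolPair`, `encList`;
  `BrickAlgebra.lean`, `StackLists.lean`, `ListBricks.lean`);
* `UnivStep.ustepFn : List Bool → List Bool` — **the universal step**, assembled from bricks
  only (`nthLF`/`setNthLF` list access, `isNilFn`, `iteFn`, `fanoutFn`, `addFn`, projections):
  fetch the instruction at the program counter, dispatch on its tag, read/write the one stack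
  it names, look the next address up in its table;
* `UnivStep.ustepFn_mem_FP : ustepFn ∈ FP`;
* `UnivStep.ustepFn_enc` — **correctness**: `ustepFn (enc P c) = enc P (FlatProg.step P c)`
  whenever the program counter is at most `|P|` and the fetched instruction names an existing
  stack (`FlatProg.Instr.WF`), in particular along every run of a compiled standard machine
  (`UnivStep.iterate_ustepFn_enc`, `UnivStep.iterate_ustepFn_enc_trCfg`).

So `k` steps of ANY machine are `k` iterations of one fixed `FP` function on the code — the
form in which space-bounded iteration (`SpaceLoop.lean`) decides the generic `PSPACE`-complete
bounded-halting language (sequel `SpaceComplete.lean`; Arora–Barak 2009, §4.2 eq. (4.3)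
`SPACE TMSAT`, Homer–Selman 2011, §7.5.1 `𝒰_PS`).

Mathlib has no universal Turing machine (searched `Computability/*`: only the universal partial
recursive `Nat.Partrec.Code.eval`, untimed); the tree's `UniversalTM2.lean` interprets standard
machines by a PRIMITIVE RECURSIVE function on `ℕ`-codes (exponential-size `Nat.pair` trees, no
time bound) — this file is its polynomial-time counterpart on string codes.

## References

* S. Arora, B. Barak, *Computational Complexity: A Modern Approach*, CUP 2009, §1.4 (machines as
  strings), Thm. 1.9 (efficient universal machine), §1.4.1 [AroraBarakCC2009].
* F. C. Hennie, R. E. Stearns, *Two-tape simulation of multitape Turing machines*, J. ACM 13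
  (1966) 533–546 (the classical overhead bound; not needed here).
-/

noncomputable section

namespace Literature.Computability.Complexity

namespace UnivStep

open _root_.Computability Brick FlatProg
open UnivTM2 (encStk)

/-! ### String codes of flat programs and configurations -/

/-- Numbers in binary (Mathlib's `encodeNat`; `bin 0 = ε`). [cite: AroraBarakCC2009, §0.1] -/
abbrev bin (n : ℕ) : List Bool := encodeNat n

/-- A stack: the coded list of its symbol numbers. [cite: AroraBarakCC2009, §1.4] -/
def encStack (s : List ℕ) : List Bool := encList (s.map bin)

/-- The stacks: the coded list of the coded stacks. [cite: AroraBarakCC2009, §1.4] -/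
def encStacks (S : List (List ℕ)) : List Bool := encList (S.map encStack)

/-- A jump table: the coded list of its addresses. [cite: AroraBarakCC2009, §1.4] -/
def encTbl (t : List ℕ) : List Bool := encList (t.map bin)

/-- An instruction: the record `⟨tag, ⟨stack index, payload⟩⟩` — `goto j ↦ ⟨ε, ⟨ε, j⟩⟩`,
`push k a j ↦ ⟨1, ⟨k, ⟨a, j⟩⟩⟩`, `pop k t ↦ ⟨0, ⟨k, t⟩⟩`. [cite: AroraBarakCC2009, §1.4] -/
def encInstr : Instr → List Bool
  | .goto j => boolPair [] (boolPair [] (bin j))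
  | .push k a j => boolPair [true] (boolPair (bin k) (boolPair (bin a) (bin j)))
  | .pop k t => boolPair [false] (boolPair (bin k) (encTbl t))

/-- A program: the coded list of its coded instructions. [cite: AroraBarakCC2009, §1.4] -/
def encProg (P : Prog) : List Bool := encList (P.map encInstr)

/-- A configuration: `⟨pc, stacks⟩`. [cite: AroraBarakCC2009, §1.4] -/
def encCfg (c : Cfg) : List Bool := boolPair (bin c.1) (encStacks c.2)

/-- The input/output of the universal step: `⟨program, ⟨pc, stacks⟩⟩`. [cite: AroraBarakCC2009, §1.4] -/
def enc (P : Prog) (c : Cfg) : List Bool := boolPair (encProg P) (encCfg c)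

/-- An instruction code is never empty. [folklore] -/
theorem encInstr_ne_nil (i : Instr) : encInstr i ≠ [] := by
  cases i <;> simp [encInstr, boolPair]

/-- The tag of a `push`. [folklore] -/
@[simp] theorem fstF_encInstr_push (k a j : ℕ) : fstF (encInstr (.push k a j)) = [true] := by
  simp [encInstr]

/-- The tag of a `pop`. [folklore] -/
@[simp] theorem fstF_encInstr_pop (k : ℕ) (t : List ℕ) : fstF (encInstr (.pop k t)) = [false] := by
  simp [encInstr]

/-- The tag of a `goto`. [folklore] -/
@[simp] theorem fstF_encInstr_goto (j : ℕ) : fstF (encInstr (.goto j)) = [] := by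
  simp [encInstr]

/-- Pushing on a coded stack is consing the code. [folklore] -/
theorem encStack_cons (a : ℕ) (s : List ℕ) : encStack (a :: s) = boolPair (bin a) (encStack s) := rfl

/-- The empty coded stack. [folklore] -/
@[simp] theorem encStack_nil : encStack [] = [] := rfl

/-- Popping a coded stack is its tail. [folklore] -/
theorem sndF_encStack (s : List ℕ) : sndF (encStack s) = encStack s.tail := by
  cases s with
  | nil => simp
  | cons a s => rw [encStack_cons, sndF_boolPair, List.tail_cons]

/-- The top of a nonempty coded stack. [folklore] -/
theorem fstF_encStack_cons (a : ℕ) (s : List ℕ) : fstF (encStack (a :: s)) = bin a := by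
  rw [encStack_cons, fstF_boolPair]

/-- A coded stack is empty iff the stack is. [folklore] -/
theorem isNilFn_encStack (s : List ℕ) : isNilFn (encStack s) = [decide (s = [])] := by
  rw [encStack, isNilFn_encList]; simp

/-! ### List access without an index bound -/

/-- `nthLF` with the list as its own yardstick needs no bound on the index: reading past the
end gives `ε`. [folklore] -/
theorem nthLF_self (k : ℕ) (L : List (List Bool)) :
    nthLF (boolPair (encList L) (boolPair (bin k) (encList L))) = L.getD k [] := by
  by_cases hk : k ≤ (encList L).length
  · exact nthLF_apply _ hk L
  · rw [nthLF, Function.comp_apply, dropLF_record, activeRounds_encodeNat,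
      min_eq_right (le_of_not_ge hk), sndF_iterate_encList, fstF_encList,
      List.drop_eq_nil_of_le (Com.length_le_length_encList L), List.getD_eq_getElem?_getD,
      List.getElem?_eq_none (le_trans (Com.length_le_length_encList L) (le_of_not_ge hk))]
    rfl

/-- Reading a coded map. [folklore] -/
theorem getD_map_nil {α : Type} (f : α → List Bool) (d : α) (hd : f d = []) (l : List α) (k : ℕ) :
    (l.map f).getD k [] = f (l.getD k d) := by
  rw [← hd, List.getD_map]

/-! ### The universal step -/

/-- The program field. [folklore] -/
def progF : List Bool → List Bool := nthF 0
/-- The program-counter field. [folklore] -/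
def pcF : List Bool → List Bool := nthF 1
/-- The stacks field. [folklore] -/
def ssF : List Bool → List Bool := sndPow 1
/-- The fetched instruction (`ε` when halted). [folklore] -/
def insF : List Bool → List Bool := nthLF ∘ fanoutFn progF (fanoutFn pcF progF)
/-- Its tag. [folklore] -/
def tagF : List Bool → List Bool := fstF ∘ insF
/-- Its stack index. [folklore] -/
def kF : List Bool → List Bool := nthF 1 ∘ insF
/-- Its payload. [folklore] -/
def payF : List Bool → List Bool := sndPow 1 ∘ insF
/-- The stack it names. [folklore] -/
def stkF : List Bool → List Bool := nthLF ∘ fanoutFn ssF (fanoutFn kF ssF)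
/-- Writing back a new content `g z` of that stack. [folklore] -/
def writeF (g : List Bool → List Bool) : List Bool → List Bool :=
  setNthLF ∘ fanoutFn ssF (fanoutFn kF (fanoutFn g ssF))
/-- Result of a `goto`: `⟨j, stacks⟩`. [folklore] -/
def gotoR : List Bool → List Bool := fanoutFn payF ssF
/-- Result of a `push`: `⟨j, stacks[k ↦ a :: stack]⟩`. [folklore] -/
def pushR : List Bool → List Bool :=
  fanoutFn (sndF ∘ payF) (writeF (fanoutFn (fstF ∘ payF) stkF))
/-- The jump-table index of a `pop`: `0` on an empty stack, `top + 1` otherwise. [folklore] -/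
def idxF : List Bool → List Bool :=
  iteFn (isNilFn ∘ stkF) (fun _ => []) (addFn ∘ fanoutFn (fstF ∘ stkF) (fun _ => [true]))
/-- Result of a `pop`: `⟨table[idx], stacks[k ↦ tail]⟩`. [folklore] -/
def popR : List Bool → List Bool :=
  fanoutFn (nthLF ∘ fanoutFn payF (fanoutFn idxF payF)) (writeF (sndF ∘ stkF))
/-- The new configuration: unchanged when halted, else by the tag. [folklore] -/
def coreF : List Bool → List Bool :=
  iteFn (isNilFn ∘ insF) sndF (iteFn (isNilFn ∘ tagF) gotoR (iteFn tagF pushR popR))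

/-- **The universal step** `⟨P, cfg⟩ ↦ ⟨P, step P cfg⟩` as a string function.
[cite: AroraBarakCC2009, §1.4 and Thm. 1.9 (efficient universal simulation)] -/
def ustepFn : List Bool → List Bool := fanoutFn progF coreF

/-! ### Polynomial time -/

/-- `progF ∈ FP`. [folklore] -/
theorem progF_mem_FP : progF ∈ FP := nthF_mem_FP 0
/-- `pcF ∈ FP`. [folklore] -/
theorem pcF_mem_FP : pcF ∈ FP := nthF_mem_FP 1
/-- `ssF ∈ FP`. [folklore] -/
theorem ssF_mem_FP : ssF ∈ FP := sndPow_mem_FP 1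
/-- `insF ∈ FP`. [folklore] -/
theorem insF_mem_FP : insF ∈ FP :=
  comp_mem_FP nthLF_mem_FP (fanoutFn_mem_FP progF_mem_FP (fanoutFn_mem_FP pcF_mem_FP progF_mem_FP))
/-- `tagF ∈ FP`. [folklore] -/
theorem tagF_mem_FP : tagF ∈ FP := comp_mem_FP fstF_mem_FP insF_mem_FP
/-- `kF ∈ FP`. [folklore] -/
theorem kF_mem_FP : kF ∈ FP := comp_mem_FP (nthF_mem_FP 1) insF_mem_FP
/-- `payF ∈ FP`. [folklore] -/
theorem payF_mem_FP : payF ∈ FP := comp_mem_FP (sndPow_mem_FP 1) insF_mem_FP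
/-- `stkF ∈ FP`. [folklore] -/
theorem stkF_mem_FP : stkF ∈ FP :=
  comp_mem_FP nthLF_mem_FP (fanoutFn_mem_FP ssF_mem_FP (fanoutFn_mem_FP kF_mem_FP ssF_mem_FP))
/-- `writeF g ∈ FP` for `g ∈ FP`. [folklore] -/
theorem writeF_mem_FP {g : List Bool → List Bool} (hg : g ∈ FP) : writeF g ∈ FP :=
  comp_mem_FP setNthLF_mem_FP
    (fanoutFn_mem_FP ssF_mem_FP (fanoutFn_mem_FP kF_mem_FP (fanoutFn_mem_FP hg ssF_mem_FP)))
/-- `gotoR ∈ FP`. [folklore] -/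
theorem gotoR_mem_FP : gotoR ∈ FP := fanoutFn_mem_FP payF_mem_FP ssF_mem_FP
/-- `pushR ∈ FP`. [folklore] -/
theorem pushR_mem_FP : pushR ∈ FP :=
  fanoutFn_mem_FP (comp_mem_FP sndF_mem_FP payF_mem_FP)
    (writeF_mem_FP (fanoutFn_mem_FP (comp_mem_FP fstF_mem_FP payF_mem_FP) stkF_mem_FP))
/-- `idxF ∈ FP`. [folklore] -/
theorem idxF_mem_FP : idxF ∈ FP :=
  iteFn_mem_FP (comp_mem_FP isNilFn_mem_FP stkF_mem_FP) (const_mem_FP _)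
    (comp_mem_FP addFn_mem_FP (fanoutFn_mem_FP (comp_mem_FP fstF_mem_FP stkF_mem_FP) (const_mem_FP _)))
/-- `popR ∈ FP`. [folklore] -/
theorem popR_mem_FP : popR ∈ FP :=
  fanoutFn_mem_FP
    (comp_mem_FP nthLF_mem_FP (fanoutFn_mem_FP payF_mem_FP (fanoutFn_mem_FP idxF_mem_FP payF_mem_FP)))
    (writeF_mem_FP (comp_mem_FP sndF_mem_FP stkF_mem_FP))
/-- `coreF ∈ FP`. [folklore] -/
theorem coreF_mem_FP : coreF ∈ FP :=
  iteFn_mem_FP (comp_mem_FP isNilFn_mem_FP insF_mem_FP) sndF_mem_FP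
    (iteFn_mem_FP (comp_mem_FP isNilFn_mem_FP tagF_mem_FP) gotoR_mem_FP
      (iteFn_mem_FP tagF_mem_FP pushR_mem_FP popR_mem_FP))

/-- **The universal step is polynomial-time.** [cite: AroraBarakCC2009, Thm. 1.9] -/
theorem ustepFn_mem_FP : ustepFn ∈ FP := fanoutFn_mem_FP progF_mem_FP coreF_mem_FP

/-! ### Correctness -/

/-- `Instr.WF n i`: the instruction names a stack below `n` (`goto` names none). [folklore] -/
def _root_.Literature.Computability.Complexity.FlatProg.Instr.WF (n : ℕ) : Instr → Prop
  | .goto _ => True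
  | .push k _ _ => k < n
  | .pop k _ => k < n

section Eval

variable (P : Prog) (pc : ℕ) (S : List (List ℕ))

/-- The fields of a code. [folklore] -/
theorem fields_enc :
    progF (enc P (pc, S)) = encProg P ∧ pcF (enc P (pc, S)) = bin pc ∧
      ssF (enc P (pc, S)) = encStacks S := by
  simp [progF, pcF, ssF, enc, encCfg]

/-- **Fetch**: the instruction field of a code is the code of `P[pc]` (`ε` past the end).
[folklore] -/
theorem insF_enc : insF (enc P (pc, S)) = (P.map encInstr).getD pc [] := by
  obtain ⟨h1, h2, -⟩ := fields_enc P pc S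
  rw [insF, Function.comp_apply, fanoutFn_apply, fanoutFn_apply, h1, h2, encProg, nthLF_self]

variable {P pc S}

/-- Fetch at a fetchable address. [folklore] -/
theorem insF_enc_of_some {i : Instr} (h : P[pc]? = some i) : insF (enc P (pc, S)) = encInstr i := by
  rw [insF_enc, List.getD_eq_getElem?_getD, List.getElem?_map, h]
  rfl

/-- Fetch past the end. [folklore] -/
theorem insF_enc_of_none (h : P[pc]? = none) : insF (enc P (pc, S)) = [] := by
  rw [insF_enc, List.getD_eq_getElem?_getD, List.getElem?_map, h]
  rfl

/-- **Read**: the stack named by a fetched instruction with index `k < |S|`. [folklore] -/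
theorem stkF_enc_of {i : Instr} (h : P[pc]? = some i) {k : ℕ} (hk : nthF 1 (encInstr i) = bin k) :
    stkF (enc P (pc, S)) = encStack (S.getD k []) := by
  obtain ⟨-, -, h3⟩ := fields_enc P pc S
  rw [stkF, Function.comp_apply, fanoutFn_apply, fanoutFn_apply, h3, kF, Function.comp_apply,
    insF_enc_of_some h, hk, encStacks, nthLF_self, getD_map_nil encStack [] rfl]

/-- **Write**: replacing the stack named by the fetched instruction (index `k < |S|`) by a stack
whose code is `g` of the code. [folklore] -/
theorem writeF_enc_of {i : Instr} (h : P[pc]? = some i) {k : ℕ} (hk : nthF 1 (encInstr i) = bin k)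
    (hkS : k < S.length) (g : List Bool → List Bool) (s' : List ℕ)
    (hg : g (enc P (pc, S)) = encStack s') :
    writeF g (enc P (pc, S)) = encStacks (S.set k s') := by
  obtain ⟨-, -, h3⟩ := fields_enc P pc S
  rw [writeF, Function.comp_apply, fanoutFn_apply, fanoutFn_apply, fanoutFn_apply, h3, kF,
    Function.comp_apply, insF_enc_of_some h, hk, hg, encStacks,
    setNthLF_apply _ (by
      have := Com.length_le_length_encList (S.map encStack); rw [List.length_map] at this; omega) _
      (by rw [List.length_map]; exact hkS),
    ← List.map_set]
  rfl

/-- The new configuration when halted: unchanged. [folklore] -/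
theorem coreF_enc_of_none (hP : P[pc]? = none) : coreF (enc P (pc, S)) = encCfg (pc, S) := by
  rw [coreF, iteFn_apply_true (by rw [Function.comp_apply, insF_enc_of_none hP]; rfl)]
  simp [enc]

/-- At a fetchable address the halting test fails. [folklore] -/
theorem coreF_enc_of_some {i : Instr} (hP : P[pc]? = some i) :
    coreF (enc P (pc, S)) = iteFn (isNilFn ∘ tagF) gotoR (iteFn tagF pushR popR) (enc P (pc, S)) := by
  rw [coreF, iteFn_apply_false (by
    rw [Function.comp_apply, insF_enc_of_some hP]; simpa [isNilFn] using encInstr_ne_nil i)]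

/-- The new configuration of a `goto`. [folklore] -/
theorem coreF_enc_goto {j : ℕ} (hP : P[pc]? = some (.goto j)) :
    coreF (enc P (pc, S)) = encCfg (j, S) := by
  have hins := insF_enc_of_some (S := S) hP
  obtain ⟨-, -, h3⟩ := fields_enc P pc S
  rw [coreF_enc_of_some hP, iteFn_apply_true (by
      rw [Function.comp_apply, tagF, Function.comp_apply, hins, fstF_encInstr_goto]; rfl),
    gotoR, fanoutFn_apply, h3, payF, Function.comp_apply, hins]
  simp [encInstr, encCfg]

/-- The new configuration of a `push`. [folklore] -/
theorem coreF_enc_push {k a j : ℕ} (hP : P[pc]? = some (.push k a j)) (hk : k < S.length) :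
    coreF (enc P (pc, S)) = encCfg (j, S.set k (a :: S.getD k [])) := by
  have hins := insF_enc_of_some (S := S) hP
  have hstk := stkF_enc_of (S := S) hP (show nthF 1 (encInstr (.push k a j)) = bin k by simp [encInstr])
  have hpay : payF (enc P (pc, S)) = boolPair (bin a) (bin j) := by
    rw [payF, Function.comp_apply, hins]; simp [encInstr]
  have hw : writeF (fanoutFn (fstF ∘ payF) stkF) (enc P (pc, S)) =
      encStacks (S.set k (a :: S.getD k [])) :=
    writeF_enc_of hP (by simp [encInstr]) hk _ _ (by
      rw [fanoutFn_apply, Function.comp_apply, hpay, fstF_boolPair, hstk, encStack_cons])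
  rw [coreF_enc_of_some hP, iteFn_apply_false (by
      rw [Function.comp_apply, tagF, Function.comp_apply, hins, fstF_encInstr_push]; rfl),
    iteFn_apply_true (by rw [tagF, Function.comp_apply, hins, fstF_encInstr_push]), pushR,
    fanoutFn_apply, hw, Function.comp_apply, hpay, sndF_boolPair]
  rfl

/-- The jump-table index of a `pop`. [folklore] -/
theorem idxF_enc_pop {k : ℕ} {t : List ℕ} (hP : P[pc]? = some (.pop k t)) :
    idxF (enc P (pc, S)) = bin (tblIdx (S.getD k []).head?) := by
  have hstk := stkF_enc_of (S := S) hP (show nthF 1 (encInstr (.pop k t)) = bin k by simp [encInstr])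
  rw [idxF]
  cases hs : S.getD k [] with
  | nil =>
    rw [iteFn_apply_true (by rw [Function.comp_apply, hstk, hs, isNilFn_encStack]; rfl)]
    rfl
  | cons a s =>
    rw [iteFn_apply_false (by rw [Function.comp_apply, hstk, hs, isNilFn_encStack]; simp),
      Function.comp_apply, fanoutFn_apply, Function.comp_apply, hstk, hs, fstF_encStack_cons,
      addFn_boolPair, bitsToNat_encodeNat]
    simp [tblIdx, bitsToNat]

/-- The new configuration of a `pop`. [folklore] -/
theorem coreF_enc_pop {k : ℕ} {t : List ℕ} (hP : P[pc]? = some (.pop k t)) (hk : k < S.length) :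
    coreF (enc P (pc, S)) =
      encCfg (t.getD (tblIdx (S.getD k []).head?) 0, S.set k (S.getD k []).tail) := by
  have hins := insF_enc_of_some (S := S) hP
  have hstk := stkF_enc_of (S := S) hP (show nthF 1 (encInstr (.pop k t)) = bin k by simp [encInstr])
  have hpay : payF (enc P (pc, S)) = encTbl t := by
    rw [payF, Function.comp_apply, hins]; simp [encInstr]
  have hw : writeF (sndF ∘ stkF) (enc P (pc, S)) = encStacks (S.set k (S.getD k []).tail) :=
    writeF_enc_of hP (by simp [encInstr]) hk _ _ (by rw [Function.comp_apply, hstk, sndF_encStack])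
  have hpc : (nthLF ∘ fanoutFn payF (fanoutFn idxF payF)) (enc P (pc, S)) =
      bin (t.getD (tblIdx (S.getD k []).head?) 0) := by
    rw [Function.comp_apply, fanoutFn_apply, fanoutFn_apply, hpay, idxF_enc_pop hP, encTbl, nthLF_self,
      getD_map_nil bin 0 rfl]
  rw [coreF_enc_of_some hP, iteFn_apply_false (by
      rw [Function.comp_apply, tagF, Function.comp_apply, hins, fstF_encInstr_pop]; rfl),
    iteFn_apply_false (by rw [tagF, Function.comp_apply, hins, fstF_encInstr_pop]), popR,
    fanoutFn_apply, hpc, hw]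
  rfl

/-- `modify` by consing is `set`ting the consed entry. [folklore] -/
theorem modify_cons_eq_set {α : Type} (l : List (List α)) {k : ℕ} (hk : k < l.length) (a : α) :
    l.modify k (fun s => a :: s) = l.set k (a :: l.getD k []) := by
  apply List.ext_getElem?
  intro j
  rw [List.getElem?_modify, List.getElem?_set]
  by_cases hkj : k = j
  · subst hkj
    simp [hk, List.getD_eq_getElem?_getD]
  · rw [if_neg hkj]
    cases l[j]? <;> simp [hkj]

/-- **Correctness of the universal step**: on the code of `(P, c)` with `pc ≤ |P|` and a fetched
instruction naming an existing stack, `ustepFn` computes the code of `(P, step P c)`.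
[cite: AroraBarakCC2009, §1.4 and Thm. 1.9] -/
theorem ustepFn_enc (P : Prog) (c : Cfg) (hwf : ∀ i, P[c.1]? = some i → i.WF c.2.length) :
    ustepFn (enc P c) = enc P (step P c) := by
  obtain ⟨pc, S⟩ := c
  obtain ⟨h1, -, -⟩ := fields_enc P pc S
  have e : ustepFn (enc P (pc, S)) = boolPair (encProg P) (coreF (enc P (pc, S))) := by
    rw [ustepFn, fanoutFn_apply, h1]
  rw [e]
  cases hP : P[pc]? with
  | none => rw [coreF_enc_of_none hP, step_of_le (List.getElem?_eq_none_iff.1 hP)]; rfl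
  | some i =>
    rw [step_of_getElem? (c := (pc, S)) hP]
    cases i with
    | goto j => rw [coreF_enc_goto hP]; rfl
    | push k a j =>
      rw [coreF_enc_push hP (hwf _ hP), Instr.apply, modify_cons_eq_set S (hwf _ hP)]; rfl
    | pop k t => rw [coreF_enc_pop hP (hwf _ hP)]; rfl

end Eval

/-! ### Along runs of compiled standard machines -/

/-- Compiled programs are well formed along coded configurations: every instruction names a
stack below `nK`. [folklore] -/
theorem wf_of_getElem?_compile (c : TM2Std.SCode) {pc : ℕ} {i : Instr}
    (h : (compile c)[pc]? = some i) : i.WF c.nK := by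
  -- every instruction of `compile c` comes from `code`, whose stack indices are `k.val`, `k : Fin nK`
  have hmem : i ∈ compile c := List.mem_of_getElem? h
  simp only [compile, List.mem_flatten, List.mem_ofFn] at hmem
  obtain ⟨l, ⟨lab, rfl⟩, hi⟩ := hmem
  revert hi
  suffices H : ∀ (q : TM2Std.SStmt c.nK c.N c.nΛ c.nσ) (base : ℕ),
      i ∈ code (FlatProg.entry c) (haltAddr c) q base → i.WF c.nK from H _ _
  intro q
  induction q with
  | push k f q ih =>
    intro base hi
    rw [code, List.mem_append] at hi
    rcases hi with hi | hi
    · simp only [blocks₁, List.mem_flatten, List.mem_ofFn] at hi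
      obtain ⟨l, ⟨s, rfl⟩, hi⟩ := hi
      rw [List.mem_singleton] at hi
      subst hi
      exact k.isLt
    · exact ih _ hi
  | peek k f q ih =>
    intro base hi
    rw [code, List.mem_append] at hi
    rcases hi with hi | hi
    · simp only [blocksP, List.mem_flatten, List.mem_ofFn] at hi
      obtain ⟨l, ⟨s, rfl⟩, hi⟩ := hi
      rw [List.mem_cons, List.mem_ofFn] at hi
      rcases hi with rfl | ⟨a, rfl⟩
      · exact k.isLt
      · exact k.isLt
    · exact ih _ hi
  | pop k f q ih =>
    intro base hi
    rw [code, List.mem_append] at hi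
    rcases hi with hi | hi
    · simp only [blocks₁, List.mem_flatten, List.mem_ofFn] at hi
      obtain ⟨l, ⟨s, rfl⟩, hi⟩ := hi
      rw [List.mem_singleton] at hi
      subst hi
      exact k.isLt
    · exact ih _ hi
  | load f q ih =>
    intro base hi
    rw [code, List.mem_append] at hi
    rcases hi with hi | hi
    · simp only [blocks₁, List.mem_flatten, List.mem_ofFn] at hi
      obtain ⟨l, ⟨s, rfl⟩, hi⟩ := hi
      rw [List.mem_singleton] at hi
      subst hi
      trivial
    · exact ih _ hi
  | branch p q₁ q₂ ih₁ ih₂ =>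
    intro base hi
    rw [code, List.mem_append, List.mem_append] at hi
    rcases hi with hi | hi | hi
    · simp only [blocks₁, List.mem_flatten, List.mem_ofFn] at hi
      obtain ⟨l, ⟨s, rfl⟩, hi⟩ := hi
      rw [List.mem_singleton] at hi
      subst hi
      trivial
    · exact ih₁ _ hi
    · exact ih₂ _ hi
  | goto f =>
    intro base hi
    rw [code, List.mem_ofFn] at hi
    obtain ⟨s, rfl⟩ := hi
    trivial
  | halt =>
    intro base hi
    rw [code, List.mem_ofFn] at hi
    obtain ⟨s, rfl⟩ := hi
    trivial

/-- Coded stack assignments have `nK` stacks. [folklore] -/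
theorem length_encStk {nK N : ℕ} (S : Fin nK → List (Fin (N + 1))) : (encStk S).length = nK := by
  rw [UnivTM2.encStk, List.length_ofFn]

/-- Every configuration of the flat run from a coded configuration has `nK` stacks. [folklore] -/
theorem length_snd_iterate_step (c : TM2Std.SCode) :
    ∀ (n : ℕ) (cfg : Cfg), cfg.2.length = c.nK → (((step (compile c))^[n]) cfg).2.length = c.nK := by
  intro n
  induction n with
  | zero => intro cfg h; exact h
  | succ n ih =>
    intro cfg h
    rw [Function.iterate_succ_apply]
    apply ih
    -- one step preserves the number of stacks
    unfold step
    cases hP : (compile c)[cfg.1]? with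
    | none => exact h
    | some i =>
      cases i with
      | goto j => exact h
      | push k a j => simp only [Instr.apply, List.length_modify]; exact h
      | pop k t => simp only [Instr.apply, List.length_set]; exact h

/-- **Iterated universal step = the flat run**, from the code of any configuration with `nK`
stacks (in particular from `trCfg` of a machine configuration). [cite: AroraBarakCC2009, Thm. 1.9] -/
theorem iterate_ustepFn_enc (c : TM2Std.SCode) (cfg : Cfg) (hcfg : cfg.2.length = c.nK) (n : ℕ) :
    ustepFn^[n] (enc (compile c) cfg) = enc (compile c) ((step (compile c))^[n] cfg) := by
  induction n with
  | zero => rfl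
  | succ n ih =>
    rw [Function.iterate_succ_apply', ih, Function.iterate_succ_apply']
    refine ustepFn_enc _ _ fun i hi => ?_
    rw [length_snd_iterate_step c n cfg hcfg]
    exact wf_of_getElem?_compile c hi

/-- The same from a coded machine configuration. [cite: AroraBarakCC2009, Thm. 1.9] -/
theorem iterate_ustepFn_enc_trCfg (c : TM2Std.SCode) (a : c.tm.Cfg) (n : ℕ) :
    ustepFn^[n] (enc (compile c) (trCfg c a)) =
      enc (compile c) ((step (compile c))^[n] (trCfg c a)) :=
  iterate_ustepFn_enc c _ (by rw [trCfg_snd, length_encStk]) n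

end UnivStep

end Literature.Computability.Complexity
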